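import Literature.Probability.LatticeModels.GKSInequalities
import Literature.Probability.LatticeModels.GriffithsMonotonicity
import Literature.Probability.Percolation.LocalLimitMeasure
import HarnessLib

/-!
# The free infinite-volume Ising state as a probability measure (thermodynamic limit of free boxes)

Topic `Literature/Probability/LatticeModels`. First half of the discharge of the named fact
`exists_freeMeasure` (`GibbsStates.lean`: the free state `⟨·⟩^∅_{β,h}` of `ℤ^d`, `β, h ≥ 0`, is a
translation-invariant DLR measure with correlations `freeCorr`). Here: **existence of the limit
measure and the identification of its local expectations**,

`∃ μ (probability measure on {±1}^{ℤ^d}), ∀ local F, ⟨F⟩^∅_{Λ_L;β,h} → ∫ F dμ`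
(`exists_measure_tendsto_isingExpect_free_box`), in particular `∫ σ_A dμ = ⟨σ_A⟩^∅_{β,h}`
(Friedli–Velenik 2017, Exercise 3.16 with Thm. 3.17 / Def. 3.14 and Thm. 6.5 (Riesz–Kolmogorov
construction of the state): "the limits `⟨f⟩ = lim ⟨f⟩^∅_{Λ_n;β,h}` exist for every local
function `f`, by GKS, and define a Gibbs state"). The DLR equations and the translation invariance
of `μ` are the second half (`FreeStateGibbs.lean`).

## Contents and proof

* `unitsIntEquivBool`, `spinConfigEquivSet V : SpinConfig V ≃ᵐ Set V` (`σ ↦ {x | σ_x = +1}`): the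
  bridge to the configuration space `Set ι` of the tree's percolation files, where the
  existence of local (thermodynamic) limits of probability measures is a theorem
  (`Literature.Probability.Percolation.exists_measure_tendsto_of_isLocalEvent`, from Kolmogorov's
  extension theorem, `LocalLimitMeasure.lean`).
* Local observables: a function of the spins in a finite `D` is a finite linear combination of
  the spin products `σ_B`, `B ⊆ D` (`exists_sum_spinProduct_of_dependsOn`; Friedli–Velenik 2017,
  Lemma 3.19), hence its free box expectations converge for `β, h ≥ 0`
  (`tendsto_isingExpect_free_box_of_dependsOn`, from the tree's `hasBoxLimit_isingCorr_free_holds`,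
  GKS) — to `freeExpect d β h F`, the `limUnder` functional of `IsingThermodynamics`.
* The limit measure (`exists_measure_tendsto_isingExpect_free_box`): the image measures on
  `Set (Site d)` converge on local events (their indicators are local observables), Kolmogorov's
  theorem gives the limit, and local expectations are recovered from the probabilities of the
  spin patterns on finite windows (`dependsOn_eq_sum_indicator_pattern`).

## Mathlib

`DependsOn`, `MeasurableEquiv.piCongrRight`, `Measure.map`, `MeasureTheory.measureReal_def`,
`ENNReal.tendsto_toReal`, `tendsto_finsetSum`. No Gibbs states in Mathlib.
-/

noncomputable section

open MeasureTheory Filter Topology Finset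
open Literature.Probability.Percolation

namespace Literature.Probability.LatticeModels

/-! ### Spin configurations as subsets -/

/-- `ℤˣ ≃ Bool`, `u ↦ [u = 1]`, as a measurable equivalence of discrete spaces. [folklore] -/
def unitsIntEquivBool : ℤˣ ≃ᵐ Bool where
  toFun u := decide (u = 1)
  invFun b := if b then 1 else -1
  left_inv u := by rcases Int.units_eq_one_or u with rfl | rfl <;> decide
  right_inv b := by cases b <;> decide
  measurable_toFun := Measurable.of_discrete
  measurable_invFun := Measurable.of_discrete

variable (V : Type*)

/-- **Spin configurations as subsets of the vertex set**: `σ ↦ {x | σ_x = +1}`, a measurable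
equivalence `{±1}^V ≃ᵐ Set V` (product σ-algebras on both sides; the configuration space of the
percolation files). [folklore] -/
def spinConfigEquivSet : SpinConfig V ≃ᵐ Set V :=
  (MeasurableEquiv.piCongrRight fun _ : V => unitsIntEquivBool).trans (boolFunEquivSet V)

variable {V}

/-- `x ∈ spinConfigEquivSet σ ↔ σ_x = +1`. [folklore] -/
@[simp] theorem mem_spinConfigEquivSet_iff (σ : SpinConfig V) (x : V) :
    x ∈ spinConfigEquivSet V σ ↔ σ x = 1 := by
  simp [spinConfigEquivSet, MeasurableEquiv.trans_apply, MeasurableEquiv.piCongrRight,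
    unitsIntEquivBool]

/-- Configurations agreeing on `F` have images agreeing on `F`. [folklore] -/
theorem spinConfigEquivSet_inter_eq {σ τ : SpinConfig V} {F : Set V} (h : ∀ x ∈ F, σ x = τ x) :
    spinConfigEquivSet V σ ∩ F = spinConfigEquivSet V τ ∩ F := by
  ext x
  simp only [Set.mem_inter_iff, mem_spinConfigEquivSet_iff]
  constructor
  · rintro ⟨hx, hxF⟩; exact ⟨(h x hxF) ▸ hx, hxF⟩
  · rintro ⟨hx, hxF⟩; exact ⟨(h x hxF).symm ▸ hx, hxF⟩

/-- The indicator of the preimage of an event determined by `F` depends only on the spins in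
`F`. [folklore] -/
theorem dependsOn_indicator_preimage_of_determinedBy {A : Set (Set V)} {F : Set V}
    (hA : DeterminedBy A F) :
    DependsOn ((spinConfigEquivSet V ⁻¹' A).indicator (1 : SpinConfig V → ℝ)) F := by
  intro σ τ hst
  have key := (determinedBy_iff A F).1 hA _ _ (spinConfigEquivSet_inter_eq hst)
  by_cases hσ : spinConfigEquivSet V σ ∈ A
  · rw [Set.indicator_of_mem (show σ ∈ spinConfigEquivSet V ⁻¹' A from hσ),
      Set.indicator_of_mem (show τ ∈ spinConfigEquivSet V ⁻¹' A from key.1 hσ)]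
    rfl
  · rw [Set.indicator_of_notMem (show σ ∉ spinConfigEquivSet V ⁻¹' A from hσ),
      Set.indicator_of_notMem (show τ ∉ spinConfigEquivSet V ⁻¹' A from fun h => hσ (key.2 h))]

/-! ### Local observables are linear combinations of spin products -/

/-- `(1 + η σ_x)/2` is the indicator of `σ_x = η` (`η, σ_x ∈ {±1}`; the variables
`n_i = (1+σ_i)/2` of Friedli–Velenik 2017, §3.6.2). [cite: FriedliVelenik2017, Lemma 3.19] -/
theorem halfOnePlusSpin_eq_indicator (x : V) (u : ℤˣ) (σ : SpinConfig V) :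
    (1 + ((u : ℤ) : ℝ) * spinAt x σ) / 2 = if σ x = u then 1 else 0 := by
  rcases Int.units_eq_one_or u with rfl | rfl <;>
    rcases Int.units_eq_one_or (σ x) with h | h <;>
    simp [spinAt, h, Units.ext_iff]

/-- `∏_{x ∈ D} (1 + η_x σ_x)/2 = 1{σ|_D = η}`. [folklore] -/
theorem prod_halfOnePlusSpin_eq_indicator (D : Finset V) (η : ↥D → ℤˣ) (σ : SpinConfig V) :
    ∏ x : ↥D, (1 + ((η x : ℤ) : ℝ) * spinAt (x : V) σ) / 2 =
      if (fun x : ↥D => σ x) = η then 1 else 0 := by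
  simp_rw [halfOnePlusSpin_eq_indicator]
  split_ifs with h
  · exact Finset.prod_eq_one fun x _ => by rw [if_pos (congrFun h x)]
  · obtain ⟨x, hx⟩ : ∃ x : ↥D, σ x ≠ η x := by
      by_contra hne
      push Not at hne
      exact h (funext hne)
    exact Finset.prod_eq_zero (Finset.mem_univ x) (if_neg hx)

/-- `∏_{x ∈ D} (1 + η_x σ_x)/2 = 2^{-|D|} ∑_{B ⊆ D} (∏_{x∈B} η_x) σ_B` (expanding the product;
Friedli–Velenik 2017, Lemma 3.19). [cite: FriedliVelenik2017, Lemma 3.19] -/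
theorem prod_halfOnePlusSpin_eq_sum_spinProduct (D : Finset V) (η : ↥D → ℤˣ) (σ : SpinConfig V) :
    ∏ x : ↥D, (1 + ((η x : ℤ) : ℝ) * spinAt (x : V) σ) / 2 =
      (2 : ℝ)⁻¹ ^ D.card * ∑ B : Finset ↥D, (∏ x ∈ B, ((η x : ℤ) : ℝ)) *
        spinProduct (B.map (Function.Embedding.subtype (· ∈ D))) σ := by
  rw [Finset.prod_div_distrib, Finset.prod_const, Finset.card_univ, Fintype.card_coe,
    Finset.prod_one_add, Finset.powerset_univ, div_eq_inv_mul, inv_pow]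
  congr 1
  refine Finset.sum_congr rfl fun B _ => ?_
  rw [Finset.prod_mul_distrib, spinProduct, Finset.prod_map]
  rfl

/-- **A function of the spins in `D` is the sum of its values against the pattern indicators**:
`F(σ) = ∑_{η ∈ {±1}^D} F(η ∨ 1) 1{σ|_D = η}` (`η ∨ 1`: `η` extended by `+1`). [folklore] -/
theorem dependsOn_eq_sum_indicator_pattern [DecidableEq V] (D : Finset V) {F : SpinConfig V → ℝ}
    (hF : DependsOn F (↑D : Set V)) (σ : SpinConfig V) :
    F σ = ∑ η : ↥D → ℤˣ, F (fun x => if hx : x ∈ D then η ⟨x, hx⟩ else 1) *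
      (if (fun x : ↥D => σ x) = η then (1 : ℝ) else 0) := by
  rw [Finset.sum_eq_single (fun x : ↥D => σ x)]
  · rw [if_pos rfl, mul_one]
    exact hF fun x hx => by rw [dif_pos (Finset.mem_coe.1 hx)]
  · intro η _ hη
    rw [if_neg (Ne.symm hη), mul_zero]
  · intro h; exact absurd (Finset.mem_univ _) h

/-- The same expansion with set indicators of the pattern events `{σ | σ|_D = η}`. [folklore] -/
theorem dependsOn_eq_sum_mul_indicator [DecidableEq V] (D : Finset V) {F : SpinConfig V → ℝ}
    (hF : DependsOn F (↑D : Set V)) (σ : SpinConfig V) :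
    F σ = ∑ η : ↥D → ℤˣ, F (fun x => if hx : x ∈ D then η ⟨x, hx⟩ else 1) *
      {τ : SpinConfig V | (fun x : ↥D => τ x) = η}.indicator (1 : SpinConfig V → ℝ) σ := by
  rw [dependsOn_eq_sum_indicator_pattern D hF σ]
  refine Finset.sum_congr rfl fun η _ => ?_
  congr 1
  rw [Set.indicator_apply]
  simp only [Set.mem_setOf_eq, Pi.one_apply]

/-- **Local observables are finite linear combinations of spin products**: for a finite `D ⊆ V`
and `F` depending only on the spins in `D` there are coefficients `c_B`, `B ⊆ D`, with
`F(σ) = ∑_B c_B σ_B` for every configuration `σ` (Friedli–Velenik 2017, Lemma 3.19: the local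
functions are spanned by the `σ_A`). [cite: FriedliVelenik2017, Lemma 3.19] -/
theorem exists_sum_spinProduct_of_dependsOn [DecidableEq V] (D : Finset V) {F : SpinConfig V → ℝ}
    (hF : DependsOn F (↑D : Set V)) :
    ∃ c : Finset ↥D → ℝ, ∀ σ : SpinConfig V, F σ =
      ∑ B : Finset ↥D, c B * spinProduct (B.map (Function.Embedding.subtype (· ∈ D))) σ := by
  refine ⟨fun B => ∑ η : ↥D → ℤˣ, F (fun x => if hx : x ∈ D then η ⟨x, hx⟩ else 1) *
    ((2 : ℝ)⁻¹ ^ D.card * ∏ x ∈ B, ((η x : ℤ) : ℝ)), fun σ => ?_⟩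
  rw [dependsOn_eq_sum_indicator_pattern D hF σ]
  simp_rw [← prod_halfOnePlusSpin_eq_indicator, prod_halfOnePlusSpin_eq_sum_spinProduct,
    Finset.mul_sum, Finset.sum_mul]
  rw [Finset.sum_comm]
  refine Finset.sum_congr rfl fun B _ => Finset.sum_congr rfl fun η _ => ?_
  ring

/-- A function of the spins in a finite `D` is measurable (it factors through the finite,
discrete space `{±1}^D`). [folklore] -/
theorem DependsOn.measurable_of_finset [DecidableEq V] (D : Finset V) {F : SpinConfig V → ℝ}
    (hF : DependsOn F (↑D : Set V)) : Measurable F := by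
  obtain ⟨c, hc⟩ := exists_sum_spinProduct_of_dependsOn D hF
  have : F = fun σ => ∑ B : Finset ↥D, c B * spinProduct (B.map (Function.Embedding.subtype (· ∈ D))) σ :=
    funext hc
  rw [this]
  exact Finset.measurable_sum _ fun B _ => (measurable_spinProduct _).const_mul _

/-- A function of the spins in a finite `D` is bounded (it takes finitely many values). [folklore] -/
theorem DependsOn.exists_bound_of_finset [DecidableEq V] (D : Finset V) {F : SpinConfig V → ℝ}
    (hF : DependsOn F (↑D : Set V)) : ∃ C : ℝ, ∀ σ, |F σ| ≤ C := by
  classical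
  refine ⟨∑ η : ↥D → ℤˣ, |F (fun x => if hx : x ∈ D then η ⟨x, hx⟩ else 1)|, fun σ => ?_⟩
  rw [dependsOn_eq_sum_indicator_pattern D hF σ]
  refine (Finset.abs_sum_le_sum_abs _ _).trans (Finset.sum_le_sum fun η _ => ?_)
  rw [abs_mul]
  refine mul_le_of_le_one_right (abs_nonneg _) ?_
  split_ifs <;> simp

/-! ### Convergence of the free box expectations of local observables -/

variable {d : ℕ}

/-- **Existence of the free thermodynamic limit on local observables** (Friedli–Velenik 2017,
Exercise 3.16: by GKS the limits `⟨σ_A⟩^∅_{β,h} = lim ⟨σ_A⟩^∅_{Λ_n;β,h}` exist for `β, h ≥ 0`,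
hence so does `lim ⟨f⟩^∅_{Λ_n;β,h}` for every local `f` (Lemma 3.19)): for `F` depending only on
the spins in a finite `D`, `⟨F⟩^∅_{Λ_L;β,h} → ⟨F⟩^∅_{β,h}` (`freeExpect`, the `limUnder`
functional of `IsingThermodynamics`, is then a genuine limit). [cite: FriedliVelenik2017, Exercise 3.16 with Lemma 3.19] -/
theorem tendsto_isingExpect_free_box_of_dependsOn {β h : ℝ} (hβ : 0 ≤ β) (hh : 0 ≤ h)
    (D : Finset (Site d)) {F : SpinConfig (Site d) → ℝ} (hF : DependsOn F (↑D : Set (Site d))) :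
    Tendsto (fun L : ℕ => isingExpect (zdGraph d) (box d L) β h .free F) atTop
      (𝓝 (freeExpect d β h F)) := by
  classical
  obtain ⟨c, hc⟩ := exists_sum_spinProduct_of_dependsOn D hF
  have hFeq : F = fun σ => ∑ B : Finset ↥D, c B *
      spinProduct (B.map (Function.Embedding.subtype (· ∈ D))) σ := funext hc
  have hlim : Tendsto (fun L : ℕ => isingExpect (zdGraph d) (box d L) β h .free F) atTop
      (𝓝 (∑ B : Finset ↥D, c B * freeCorr d β h (B.map (Function.Embedding.subtype (· ∈ D))))) := by
    rw [hFeq]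
    have hlin : ∀ L : ℕ, isingExpect (zdGraph d) (box d L) β h .free (fun σ => ∑ B : Finset ↥D, c B *
        spinProduct (B.map (Function.Embedding.subtype (· ∈ D))) σ) =
        ∑ B : Finset ↥D, c B * isingCorr (zdGraph d) (box d L) β h .free
          (B.map (Function.Embedding.subtype (· ∈ D))) := by
      intro L
      rw [isingExpect_finset_sum' _ _ _ _ β _ _ fun B => (measurable_spinProduct _).const_mul (c B)]
      refine Finset.sum_congr rfl fun B _ => ?_
      rw [isingExpect_const_mul' _ _ _ _ β (c B) (measurable_spinProduct _)]
      rfl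
    simp_rw [hlin]
    exact tendsto_finsetSum _ fun B _ =>
      (hasBoxLimit_isingCorr_free_holds (d := d) hβ hh _).const_mul _
  have heq : freeExpect d β h F =
      ∑ B : Finset ↥D, c B * freeCorr d β h (B.map (Function.Embedding.subtype (· ∈ D))) :=
    hlim.limUnder_eq
  rw [heq]
  exact hlim

/-! ### The limit measure -/

/-- The spin pattern event `{σ | σ|_D = η}` is measurable. [folklore] -/
theorem measurableSet_pattern (D : Finset (Site d)) (η : ↥D → ℤˣ) :
    MeasurableSet {σ : SpinConfig (Site d) | (fun x : ↥D => σ x) = η} := by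
  have : {σ : SpinConfig (Site d) | (fun x : ↥D => σ x) = η} =
      ⋂ x : ↥D, (fun σ : SpinConfig (Site d) => σ x) ⁻¹' {η x} := by
    ext σ
    simp only [Set.mem_setOf_eq, Set.mem_iInter, Set.mem_preimage, Set.mem_singleton_iff]
    exact ⟨fun h x => congrFun h x, fun h => funext h⟩
  rw [this]
  exact MeasurableSet.iInter fun x => measurable_pi_apply (x : Site d) (measurableSet_singleton _)

/-- The spin pattern event is the preimage of a local event of `Set (Site d)`. [folklore] -/
theorem pattern_eq_preimage (D : Finset (Site d)) (η : ↥D → ℤˣ) :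
    {σ : SpinConfig (Site d) | (fun x : ↥D => σ x) = η} =
      spinConfigEquivSet (Site d) ⁻¹' {ω : Set (Site d) | ∀ x : ↥D, ((x : Site d) ∈ ω ↔ η x = 1)} := by
  ext σ
  simp only [Set.mem_setOf_eq, Set.mem_preimage, mem_spinConfigEquivSet_iff]
  constructor
  · intro h x
    rw [← congrFun h x]
  · intro h
    funext x
    rcases Int.units_eq_one_or (σ x) with h1 | h1 <;> rcases Int.units_eq_one_or (η x) with h2 | h2
    · rw [h1, h2]
    · exact absurd ((h x).1 h1) (by rw [h2]; decide)
    · exact absurd ((h x).2 h2) (by rw [h1]; decide)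
    · rw [h1, h2]

/-- The pattern event of `Set (Site d)` is local (determined by `D`). [folklore] -/
theorem isLocalEvent_patternSet (D : Finset (Site d)) (η : ↥D → ℤˣ) :
    IsLocalEvent {ω : Set (Site d) | ∀ x : ↥D, ((x : Site d) ∈ ω ↔ η x = 1)} := by
  refine ⟨D, (determinedBy_iff _ _).2 fun ω ω' hωω' => ?_⟩
  simp only [Set.mem_setOf_eq]
  have key : ∀ x : ↥D, ((x : Site d) ∈ ω ↔ (x : Site d) ∈ ω') := fun x =>
    ⟨fun hx => ((Set.ext_iff.1 hωω' x).1 ⟨hx, x.2⟩).1,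
     fun hx => ((Set.ext_iff.1 hωω' x).2 ⟨hx, x.2⟩).1⟩
  exact forall_congr' fun x => by rw [key x]

/-- **The free infinite-volume state as a probability measure** (Friedli–Velenik 2017,
Exercise 3.16 with Thm. 6.5 / Def. 6.4: the state `f ↦ lim ⟨f⟩^∅_{Λ_n;β,h}` on local functions is
represented by a unique probability measure on `{±1}^{ℤ^d}`). For `β, h ≥ 0` there is a
probability measure `μ` on `SpinConfig (Site d)` such that for every `F` depending on finitely
many spins, `⟨F⟩^∅_{Λ_L;β,h} → ∫ F dμ`; in particular `∫ F dμ = freeExpect d β h F` and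
`spinCorr μ A = freeCorr d β h A`. Construction: the images of the free box measures on
`Set (Site d)` converge on local events, whose indicators are local observables; Kolmogorov's
extension theorem (`exists_measure_tendsto_of_isLocalEvent`) gives the limit; local expectations
are sums over the finitely many spin patterns of a window. [cite: FriedliVelenik2017, Exercise 3.16 with Thm. 6.5] -/
theorem exists_measure_tendsto_isingExpect_free_box (d : ℕ) {β h : ℝ} (hβ : 0 ≤ β) (hh : 0 ≤ h) :
    ∃ μ : Measure (SpinConfig (Site d)), IsProbabilityMeasure μ ∧
      ∀ (D : Finset (Site d)) (F : SpinConfig (Site d) → ℝ), DependsOn F (↑D : Set (Site d)) →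
        Tendsto (fun L : ℕ => isingExpect (zdGraph d) (box d L) β h .free F) atTop
          (𝓝 (∫ σ, F σ ∂μ)) := by
  classical
  set e := spinConfigEquivSet (Site d) with he
  set ν : ℕ → Measure (SpinConfig (Site d)) := fun L => isingMeasure (zdGraph d) (box d L) β h .free
    with hν
  set μs : ℕ → Measure (Set (Site d)) := fun L => (ν L).map e with hμs
  haveI : ∀ L, IsProbabilityMeasure (μs L) := fun L =>
    Measure.isProbabilityMeasure_map e.measurable.aemeasurable
  -- expansion of the integral of a local observable along the spin patterns of its window
  have hexp : ∀ (D : Finset (Site d)) (F : SpinConfig (Site d) → ℝ), DependsOn F (↑D : Set (Site d)) →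
      ∀ (ρ : Measure (SpinConfig (Site d))) [IsProbabilityMeasure ρ],
        ∫ σ, F σ ∂ρ = ∑ η : ↥D → ℤˣ, F (fun x => if hx : x ∈ D then η ⟨x, hx⟩ else 1) *
          ρ.real {σ : SpinConfig (Site d) | (fun x : ↥D => σ x) = η} := by
    intro D F hF ρ _
    have hFeq : (fun σ => F σ) = fun σ => ∑ η : ↥D → ℤˣ,
        F (fun x => if hx : x ∈ D then η ⟨x, hx⟩ else 1) *
          {τ : SpinConfig (Site d) | (fun x : ↥D => τ x) = η}.indicator (1 : SpinConfig (Site d) → ℝ) σ :=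
      funext (dependsOn_eq_sum_mul_indicator D hF)
    rw [hFeq, integral_finsetSum]
    · refine Finset.sum_congr rfl fun η _ => ?_
      rw [integral_const_mul, integral_indicator_one (measurableSet_pattern D η)]
    · intro η _
      exact (show Integrable ({τ : SpinConfig (Site d) | (fun x : ↥D => τ x) = η}.indicator
          (1 : SpinConfig (Site d) → ℝ)) ρ from
        (integrable_const (1 : ℝ)).indicator (measurableSet_pattern D η)).const_mul _
  -- convergence on local events of `Set (Site d)`
  have hconv : ∀ A : Set (Set (Site d)), IsLocalEvent A →
      ∃ a : ENNReal, Tendsto (fun L => μs L A) atTop (𝓝 a) := by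
    intro A hA
    obtain ⟨J, hJ⟩ := hA
    have hAm : MeasurableSet A := measurableSet_of_isLocalEvent_holds ⟨J, hJ⟩
    set χ : SpinConfig (Site d) → ℝ := (e ⁻¹' A).indicator 1 with hχ
    have hχdep : DependsOn χ (↑J : Set (Site d)) := dependsOn_indicator_preimage_of_determinedBy hJ
    have hval : ∀ L, μs L A = ENNReal.ofReal (isingExpect (zdGraph d) (box d L) β h .free χ) := by
      intro L
      change ((ν L).map e) A = _
      rw [Measure.map_apply e.measurable hAm, isingExpect, hχ,
        integral_indicator_one (e.measurable hAm), ofReal_measureReal]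
    refine ⟨ENNReal.ofReal (freeExpect d β h χ), ?_⟩
    simp_rw [hval]
    exact ENNReal.tendsto_ofReal (tendsto_isingExpect_free_box_of_dependsOn hβ hh J hχdep)
  obtain ⟨μ', hμ'P, hμ'⟩ := exists_measure_tendsto_of_isLocalEvent μs hconv
  haveI := hμ'P
  haveI hμP : IsProbabilityMeasure (μ'.map e.symm) :=
    Measure.isProbabilityMeasure_map e.symm.measurable.aemeasurable
  refine ⟨μ'.map e.symm, hμP, ?_⟩
  intro D F hF
  -- probabilities of the spin patterns of the window `D` converge
  have hpat : ∀ η : ↥D → ℤˣ,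
      Tendsto (fun L => (ν L).real {σ : SpinConfig (Site d) | (fun x : ↥D => σ x) = η}) atTop
        (𝓝 ((μ'.map e.symm).real {σ : SpinConfig (Site d) | (fun x : ↥D => σ x) = η})) := by
    intro η
    set P : Set (Set (Site d)) := {ω | ∀ x : ↥D, ((x : Site d) ∈ ω ↔ η x = 1)} with hP
    have hPloc : IsLocalEvent P := isLocalEvent_patternSet D η
    have hPm : MeasurableSet P := measurableSet_of_isLocalEvent_holds hPloc
    have h1 : ∀ L, (ν L) {σ : SpinConfig (Site d) | (fun x : ↥D => σ x) = η} = μs L P := by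
      intro L
      rw [pattern_eq_preimage]
      change (ν L) (e ⁻¹' P) = ((ν L).map e) P
      rw [Measure.map_apply e.measurable hPm]
    have h2 : (μ'.map e.symm) {σ : SpinConfig (Site d) | (fun x : ↥D => σ x) = η} = μ' P := by
      rw [pattern_eq_preimage]
      change (μ'.map e.symm) (e ⁻¹' P) = μ' P
      rw [Measure.map_apply e.symm.measurable (e.measurable hPm), MeasurableEquiv.symm_preimage_preimage]
    simp_rw [measureReal_def, h1, h2]
    exact (ENNReal.tendsto_toReal (measure_ne_top μ' P)).comp (hμ' P hPloc)
  rw [hexp D F hF (μ'.map e.symm)]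
  have hL : ∀ L, isingExpect (zdGraph d) (box d L) β h .free F =
      ∑ η : ↥D → ℤˣ, F (fun x => if hx : x ∈ D then η ⟨x, hx⟩ else 1) *
        (ν L).real {σ : SpinConfig (Site d) | (fun x : ↥D => σ x) = η} := fun L =>
    hexp D F hF (ν L)
  simp_rw [hL]
  exact tendsto_finsetSum _ fun η _ => (hpat η).const_mul _

/-- **Consequences for the limit measure**: its local expectations are the free state
`freeExpect d β h` (which is therefore a genuine limit on local observables) and its correlations
are `freeCorr d β h`. [cite: FriedliVelenik2017, Exercise 3.16] -/
theorem exists_measure_integral_eq_freeExpect (d : ℕ) {β h : ℝ} (hβ : 0 ≤ β) (hh : 0 ≤ h) :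
    ∃ μ : Measure (SpinConfig (Site d)), IsProbabilityMeasure μ ∧
      (∀ (D : Finset (Site d)) (F : SpinConfig (Site d) → ℝ), DependsOn F (↑D : Set (Site d)) →
        Tendsto (fun L : ℕ => isingExpect (zdGraph d) (box d L) β h .free F) atTop (𝓝 (∫ σ, F σ ∂μ)) ∧
          ∫ σ, F σ ∂μ = freeExpect d β h F) ∧
      ∀ A : Finset (Site d), spinCorr μ A = freeCorr d β h A := by
  obtain ⟨μ, hμP, hμ⟩ := exists_measure_tendsto_isingExpect_free_box d hβ hh
  refine ⟨μ, hμP, fun D F hF => ⟨hμ D F hF, ?_⟩, fun A => ?_⟩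
  · exact tendsto_nhds_unique (tendsto_isingExpect_free_box_of_dependsOn hβ hh D hF) (hμ D F hF) ▸ rfl
  · have hdep : DependsOn (spinProduct A : SpinConfig (Site d) → ℝ) (↑A : Set (Site d)) :=
      fun σ τ hst => Finset.prod_congr rfl fun x hx => by
        simp only [spinAt, hst x (Finset.mem_coe.2 hx)]
    have h1 := hμ A (spinProduct A) hdep
    have h2 : Tendsto (fun L : ℕ => isingExpect (zdGraph d) (box d L) β h .free (spinProduct A)) atTop
        (𝓝 (freeCorr d β h A)) := hasBoxLimit_isingCorr_free_holds (d := d) hβ hh A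
    exact tendsto_nhds_unique h1 h2

end Literature.Probability.LatticeModels

end
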